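import Mathlib
import Literature.Computability.Complexity.ExtMonotoneGRankSupport
import Summits.PneNP.PneNP.Theorems.ConvexRankGatesCaptureGRankAndOr
import Summits.PneNP.PneNP.Theorems.ConvexRankGatesCaptureGRankNormalForm

/-!
# Wideness is free, GRANK: the `∧`-padding of a GRANK gate is a GRANK gate (`isGRankGate_andPad`)
(crux `ConvexRankGates.CliqueExtLowerBound`, stmt-PneNP-10682; line `width-threshold-certificate-sparsity`,
reshape r8 of lead c12, registered sub-goal `isGRankGate_andPad`; `--supports stmt-PneNP-10682`)

The padded gate of a gate `φ` of fan-in `n` by `n'` dummy wires is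
`⟨n + n', v ↦ φ (v ∘ castAdd) && [∀ j, v (natAdd n j)]⟩` (written inline, no definition). We prove: if `φ` is a
GRANK gate of size parameter `s` (field `F`, dimension `d ≤ s`, threshold `θ`, pencil `K₀, Kᵢ`), then the padded
gate is a GRANK gate of size parameter `s + (s+1) n'` (`isGRankGate_andPad`; the dimension used is in fact
`≤ s + n'`).

Proof. If `θ > d` the gate, hence the padded gate, never accepts: take the empty (`0 × 0`) pencil with threshold
`1`. If `θ ≤ d`, first pass to the FULL-RANK normal form of the gate (landed
`Capture.GRankAlgebra.fullRank_form`: over the purely transcendental extension `F' = Frac F[u, w]` the gate is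
`v ↦ [θ ≤ rank (L₀ + ∑_{vᵢ=1} Xᵢ Lᵢ)]` with `θ × θ` data). Then take the block-diagonal pencil of dimension `θ + n'`
over `F'`: the old data on the old wires (zero on the dummies) in the first block, and for dummy `j` the diagonal
matrix unit `E_jj` in the second block, threshold `θ + n'` (full rank). By the landed `∧`-closure of full-rank
gates (`Capture.GRankAlgebra.and_fullRank_iff`: `det` of a block-diagonal matrix is the product of the blocks'
determinants) the new gate accepts `v` iff the old block has full rank at `v` AND the dummy block
`diag (X_{n+j} [v_{n+j}])_j` has full rank, i.e. iff `φ` accepts `v ∘ castAdd` (the old block is the old symbolic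
matrix with its variables renamed along the injective `castAdd : Fin n → Fin (n + n')`, which does not change the
vanishing of minors, `le_rank_symbolicMatrix_append_iff`) and every dummy is on (`le_rank_dummies_iff`).
No new definitions. [folklore]
-/

set_option linter.dupNamespace false

namespace Summit.PneNP.PneNP.Theorems.CliqueExtLowerBound.WidthThreshold.GRankAndPad

open Literature.Computability.Complexity Finset MvPolynomial Matrix

/-! ## §1 Extending the variable set: old data on the old wires, zero on the new wires -/

section Extend

variable {F : Type*} [Field F] {n n' d : ℕ}

/-- The generic symbolic matrix of the data `(K₀; K on the first n wires, 0 on the last n' wires)` is the old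
generic symbolic matrix with its variables renamed along `castAdd : Fin n → Fin (n + n')`. [folklore] -/
theorem symbolicPolyMatrix_append (K₀ : Matrix (Fin d) (Fin d) F) (K : Fin n → Matrix (Fin d) (Fin d) F) :
    symbolicPolyMatrix K₀ (Fin.append K fun _ : Fin n' => (0 : Matrix (Fin d) (Fin d) F)) =
      (symbolicPolyMatrix K₀ K).map (rename (Fin.castAdd n')) := by
  ext a b
  simp only [symbolicPolyMatrix, Matrix.add_apply, Matrix.map_apply, Matrix.sum_apply,
    Matrix.smul_apply, smul_eq_mul, map_add, map_sum, map_mul, rename_X, rename_C,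
    Fin.sum_univ_add, Fin.append_left, Fin.append_right, Matrix.zero_apply, map_zero, mul_zero,
    Finset.sum_const_zero, add_zero]

/-- Killing the unselected variables commutes with the renaming `castAdd` (the selection of the old wires is
read off through `castAdd`). [folklore] -/
theorem killVars_rename_castAdd (v : Fin (n + n') → Bool) (p : MvPolynomial (Fin n) F) :
    killVars v (rename (Fin.castAdd n') p) =
      rename (Fin.castAdd n') (killVars (fun i => v (Fin.castAdd n' i)) p) := by
  have h : (killVars (F := F) v).comp (rename (Fin.castAdd n')) =
      (rename (Fin.castAdd n')).comp (killVars (F := F) fun i => v (Fin.castAdd n' i)) := by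
    refine MvPolynomial.algHom_ext fun i => ?_
    simp only [AlgHom.comp_apply, rename_X, killVars_X]
    split_ifs <;> simp [rename_X]
  exact AlgHom.congr_fun h p

/-- **Dummy wires with zero data do not move a GRANK gate**: the data `(K₀; K, 0)` on `n + n'` wires accept
`v` at threshold `θ` iff the data `(K₀; K)` accept the restriction of `v` to the old wires (a `θ × θ` minor of
the new symbolic matrix is the renamed old minor, and renaming along an injection is injective). [folklore] -/
theorem le_rank_symbolicMatrix_append_iff (K₀ : Matrix (Fin d) (Fin d) F)
    (K : Fin n → Matrix (Fin d) (Fin d) F) (v : Fin (n + n') → Bool) (θ : ℕ) :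
    θ ≤ (symbolicMatrix K₀ (Fin.append K fun _ : Fin n' => (0 : Matrix (Fin d) (Fin d) F)) v).rank ↔
      θ ≤ (symbolicMatrix K₀ K fun i => v (Fin.castAdd n' i)).rank := by
  rw [Literature.LinearAlgebra.Matrix.le_rank_iff_exists_det_submatrix_ne_zero,
    Literature.LinearAlgebra.Matrix.le_rank_iff_exists_det_submatrix_ne_zero]
  refine exists_congr fun r => exists_congr fun c => ?_
  rw [Ne, det_submatrix_symbolicMatrix_eq_zero_iff, Ne, det_submatrix_symbolicMatrix_eq_zero_iff,
    symbolicPolyMatrix_append, Matrix.submatrix_map, ← AlgHom.mapMatrix_apply, ← AlgHom.map_det,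
    killVars_rename_castAdd,
    map_eq_zero_iff _ (rename_injective _ (Fin.castAdd_injective _ _))]

/-! ## §2 The dummy block: `diag (X_{n+j} [v_{n+j}])_j` -/

/-- The symbolic matrix of the dummy data (`0`; `E_jj` on dummy `j`, `0` on the old wires) is the diagonal
matrix with entry `X_{n+j}` if dummy `j` is on and `0` otherwise. [folklore] -/
theorem symbolicMatrix_dummies (v : Fin (n + n') → Bool) :
    symbolicMatrix (0 : Matrix (Fin n') (Fin n') F)
        (fun t => Matrix.diagonal fun j : Fin n' => if t = Fin.natAdd n j then (1 : F) else 0) v =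
      Matrix.diagonal fun j : Fin n' => if v (Fin.natAdd n j) then
        algebraMap (MvPolynomial (Fin (n + n')) F) (FractionRing (MvPolynomial (Fin (n + n')) F))
          (X (Fin.natAdd n j)) else 0 := by
  ext a b
  rw [Capture.GRankAlgebra.symbolicMatrix_apply, Matrix.zero_apply, map_zero, zero_add]
  by_cases hab : a = b
  · subst hab
    rw [Matrix.diagonal_apply_eq, Finset.sum_eq_single (Fin.natAdd n a)]
    · simp only [Matrix.diagonal_apply_eq]
      split_ifs <;> simp
    · intro t _ ht
      rw [Matrix.diagonal_apply_eq, if_neg ht, map_zero, mul_zero, ite_self]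
    · intro h
      exact absurd (Finset.mem_univ _) h
  · rw [Matrix.diagonal_apply_ne _ hab]
    refine Finset.sum_eq_zero fun t _ => ?_
    rw [Matrix.diagonal_apply_ne _ hab, map_zero, mul_zero, ite_self]

/-- The dummy block has full rank `n'` iff every dummy is on (its determinant is `∏ⱼ X_{n+j} [v_{n+j}]`).
[folklore] -/
theorem le_rank_dummies_iff (v : Fin (n + n') → Bool) :
    n' ≤ (symbolicMatrix (0 : Matrix (Fin n') (Fin n') F)
        (fun t => Matrix.diagonal fun j : Fin n' => if t = Fin.natAdd n j then (1 : F) else 0) v).rank ↔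
      ∀ j : Fin n', v (Fin.natAdd n j) = true := by
  rw [symbolicMatrix_dummies, le_rank_iff_det_ne_zero_of_sq, Matrix.det_diagonal,
    Finset.prod_ne_zero_iff]
  refine ⟨fun h j => ?_, fun h j _ => ?_⟩
  · by_contra hv
    exact h j (Finset.mem_univ j) (by rw [if_neg hv])
  · rw [if_pos (h j)]
    exact (map_ne_zero_iff _ (IsFractionRing.injective (MvPolynomial (Fin (n + n')) F)
      (FractionRing (MvPolynomial (Fin (n + n')) F)))).2 (X_ne_zero _)

end Extend

/-! ## §3 The registered sub-goal -/

open Classical in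
/-- **The `∧`-padding of a GRANK gate is a GRANK gate** (registered sub-goal `isGRankGate_andPad` of the line
`width-threshold-certificate-sparsity`, reshape r8): if `φ` is a GRANK gate of size parameter `s` then
`⟨φ.1 + n', v ↦ φ.2 (v ∘ castAdd) && [∀ j, v (natAdd φ.1 j)]⟩` is a GRANK gate of size parameter
`s + (s+1) n'` — constant-false gates (`θ > d`) by the empty pencil with threshold `1`; otherwise the block
sum of the full-rank normal form of `φ` (dimension `θ ≤ d ≤ s`, over `Frac F[u, w]`) and of the `n'` diagonal
matrix units of the dummies, at full-rank threshold `θ + n'`. [folklore] -/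
theorem isGRankGate_andPad : ∀ (s n' : ℕ) (φ : GateFn), IsGRankGate s φ →
    IsGRankGate (s + (s + 1) * n') ⟨φ.1 + n', fun v => φ.2 (fun i => v (Fin.castAdd n' i)) &&
        decide (∀ j : Fin n', v (Fin.natAdd φ.1 j) = true)⟩ := by
  intro s n' φ hφ
  obtain ⟨F, _, d, θ, hd, K₀, K, hg⟩ := hφ
  by_cases hθ : θ ≤ d
  · -- full-rank normal form over `F' = Frac F[u, w]`, then the block sum with the dummy block
    obtain ⟨L₀, L, hL⟩ := Capture.GRankAlgebra.fullRank_form θ K₀ K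
    have hn' : n' ≤ (s + 1) * n' := Nat.le_mul_of_pos_left n' (Nat.succ_pos s)
    refine ⟨_, inferInstance, θ + n', θ + n', by omega,
      Matrix.reindex finSumFinEquiv finSumFinEquiv (Matrix.fromBlocks L₀ 0 0 (0 : Matrix (Fin n') (Fin n') _)),
      fun t : Fin (φ.1 + n') => Matrix.reindex finSumFinEquiv finSumFinEquiv (Matrix.fromBlocks
        (Fin.append L (fun _ : Fin n' => (0 : Matrix (Fin θ) (Fin θ) _)) t) 0 0
        (Matrix.diagonal fun j : Fin n' => if t = Fin.natAdd φ.1 j then (1 : _) else 0)), fun v => ?_⟩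
    change (φ.2 (fun i => v (Fin.castAdd n' i)) &&
        decide (∀ j : Fin n', v (Fin.natAdd φ.1 j) = true)) = true ↔ _
    rw [Bool.and_eq_true, decide_eq_true_iff, hg, ← hL, Capture.GRankAlgebra.and_fullRank_iff,
      le_rank_symbolicMatrix_append_iff, le_rank_dummies_iff]
  · -- `θ > d`: neither gate ever accepts; the empty pencil with threshold `1`
    refine ⟨F, inferInstance, 0, 1, Nat.zero_le _, 0, fun _ => 0, fun v => ?_⟩
    change (φ.2 (fun i => v (Fin.castAdd n' i)) &&
        decide (∀ j : Fin n', v (Fin.natAdd φ.1 j) = true)) = true ↔ _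
    rw [Bool.and_eq_true, hg]
    constructor
    · rintro ⟨h, -⟩
      exact absurd (h.trans (Matrix.rank_le_width _)) hθ
    · intro h
      have h0 := h.trans (Matrix.rank_le_width _)
      omega

end Summit.PneNP.PneNP.Theorems.CliqueExtLowerBound.WidthThreshold.GRankAndPad
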